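import Literature.NumberTheory.LFunctions.BCHMollifierPoly
import Literature.NumberTheory.LFunctions.HardyZSqTwistedMoment
import Literature.NumberTheory.LFunctions.LevinsonMeanSquareOffDiagonal
import HarnessLib

/-!
# The cross term of the BCH mean square as a quadruple sum of activated stationary-phase integrals

Topic `Literature/NumberTheory/LFunctions`. Everything in this file is PROVED (no definitions, no
named facts).

In the decomposition `|ζ(½+it)|²|A|² = 2|S_t A|² + Θ²S_t²|A|² + conj(…) + O(…)`
(`Literature/NumberTheory/LFunctions/BCHZetaSqDecomposition.lean`; `S_t = Σ_{n ≤ ⌊√(t/2π)⌋} n^{-1/2-it}`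
the activated main sum, `Θ = TwistedMoment.thetaMainPhase`, `A = BCH.mollPoly a N`) the cross term is
`C(T) = ∫_T^{2T} Θ(t)² S_t² |A(½+it)|² dt`. As in Titchmarsh §9.22 (the tree's
`TwistedMoment.lemma922_integral_eq`, there for a frozen length `P` and one pair `(m, n)`), the phases
combine (`TwistedMoment.lemma922_phase_eq`):
`Θ² · μ^{-it} ν^{-it} · (k/h)^{it} = e^{-iπ/4} e^{it log(t/(e c))}`, `c = 2πμνh/k`, and the activation of
`S_t` (`n ≤ ⌊√(t/2π)⌋ ↔ 2πn² ≤ t`) becomes an indicator in each integral: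

* `BCH.crossIntegrand_eq` — pointwise, for `t > 0` with `⌊√(t/2π)⌋ ≤ X`:
  `Θ²S_t²|A|² = Σ_{h,k ≤ N} Σ_{μ,ν ≤ X} [2πμ² ≤ t][2πν² ≤ t] a_h ā_k (hk)^{-1/2}(μν)^{-1/2} e^{-iπ/4} e^{it log(t/(ec))}`;
* `BCH.intervalIntegrable_crossIntegrand`, `BCH.intervalIntegrable_normSq_actProd` — the two
  structured pieces of the decomposition are interval integrable on `[T, T']` (`0 < T`) (the
  hypotheses `hF₃`, `hF₂` of `BCH.norm_integral_zetaSq_mul_sub_le`);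
* `BCH.crossTerm_eq` — **the cross term as a quadruple sum**: for `0 < T ≤ T'`, `⌊√(T'/2π)⌋ ≤ X`,
  `∫_T^{T'} Θ²S_t²|A|² dt = e^{-iπ/4} Σ_{h,k ≤ N} a_h ā_k (hk)^{-1/2} Σ_{μ,ν ≤ X} (μν)^{-1/2}`
  `    · ∫_T^{T'} [2πμ² ≤ t ∧ 2πν² ≤ t] e^{it log(t/(e·2πμνh/k))} dt`.
  Each inner integral is `∫_{max(T, 2π max(μ,ν)²)}^{T'}` of the log-phase exponential (or `0`), to which
  the sharp stationary-phase lemma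
  `Literature.Analysis.Fourier.norm_logPhaseIntegral_sub_indicator_main_le_sharp` applies.

## References

* [Titchmarsh1986] E. C. Titchmarsh, *The Theory of the Riemann Zeta-Function*, 2nd ed. (1986), §9.22
  (first display of the proof of Lemma 9.22), §7.4.
* [Levinson1974] N. Levinson, Adv. Math. 13 (1974), §4 (the same expansion with `t`-dependent length).
-/

noncomputable section

open Finset Real Complex MeasureTheory Set intervalIntegral
open scoped ComplexConjugate

namespace Literature.NumberTheory.LFunctions.BCH

open Literature.NumberTheory.LFunctions.TwistedMoment

/-! ### The activated main sum on `[0, T']` -/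

/-- The length `⌊√(t/2π)⌋` is monotone: for `0 ≤ t ≤ T'`, `⌊√(t/2π)⌋ ≤ ⌊√(T'/2π)⌋`. [folklore] -/
theorem natFloor_sqrt_mono {t T' : ℝ} (htT' : t ≤ T') :
    ⌊Real.sqrt (t / (2 * π))⌋₊ ≤ ⌊Real.sqrt (T' / (2 * π))⌋₊ :=
  Nat.floor_le_floor (Real.sqrt_le_sqrt (div_le_div_of_nonneg_right htT' (by positivity)))

/-- The activated main sum: for `0 ≤ t` and `⌊√(t/2π)⌋ ≤ X`,
`S_t = Σ_{μ ≤ X} [2πμ² ≤ t] μ^{-1/2} e^{-it log μ}`. [folklore] -/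
theorem mainSum_natFloor_eq_sum_ite {t : ℝ} (ht : 0 ≤ t) {X : ℕ} (hX : ⌊Real.sqrt (t / (2 * π))⌋₊ ≤ X) :
    mainSum ⌊Real.sqrt (t / (2 * π))⌋₊ t =
      ∑ μ ∈ Finset.Icc 1 X, (if 2 * π * (μ : ℝ) ^ 2 ≤ t then
        (((μ : ℝ) ^ (-(1 / 2 : ℝ)) : ℝ) : ℂ) * cexp (-(I * t * Real.log μ)) else 0) := by
  rw [mainSum_def]
  exact LevinsonMS.sum_Icc_natFloor_eq_sum_ite ht hX _

/-! ### The integrand as a quadruple sum -/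

/-- Product of two activated terms: the `ℂ` case of Mathlib's `ite_zero_mul_ite_zero`, kept under
its old name as a deprecated alias (dedup-00684); use the Mathlib lemma. [folklore] -/
@[deprecated ite_zero_mul_ite_zero (since := "2026-08-15")]
theorem ite_mul_ite_zero {p q : Prop} [Decidable p] [Decidable q] (a b : ℂ) :
    (if p then a else 0) * (if q then b else 0) = if p ∧ q then a * b else 0 :=
  ite_zero_mul_ite_zero p q a b

/-- **The cross-term integrand as a quadruple sum.** For `t > 0` with `⌊√(t/2π)⌋ ≤ X`:
`Θ(t)² S_t² |A(½+it)|² = Σ_{h,k ≤ N} Σ_{μ,ν ≤ X} [2πμ² ≤ t ∧ 2πν² ≤ t] ·`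
`  a_h ā_k (hk)^{-1/2} (μν)^{-1/2} e^{-iπ/4} e^{it log(t/(e·2πμνh/k))}`. [cite: Titchmarsh1986, §9.22] -/
theorem crossIntegrand_eq (a : ℕ → ℂ) (N : ℕ) {t : ℝ} (ht : 0 < t) {X : ℕ}
    (hX : ⌊Real.sqrt (t / (2 * π))⌋₊ ≤ X) :
    thetaMainPhase t ^ 2 * (mainSum ⌊Real.sqrt (t / (2 * π))⌋₊ t) ^ 2 *
        (((‖mollPoly a N t‖ ^ 2 : ℝ)) : ℂ) =
      ∑ h ∈ Finset.Icc 1 N, ∑ k ∈ Finset.Icc 1 N, ∑ μ ∈ Finset.Icc 1 X, ∑ ν ∈ Finset.Icc 1 X,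
        (if 2 * π * (μ : ℝ) ^ 2 ≤ t ∧ 2 * π * (ν : ℝ) ^ 2 ≤ t then
          a h * conj (a k) * ((((h : ℝ) * k) ^ (-(1 / 2 : ℝ)) : ℝ) : ℂ) *
            ((((μ : ℝ) * ν) ^ (-(1 / 2 : ℝ)) : ℝ) : ℂ) *
            (cexp (-(I * (π / 4 : ℝ))) *
              cexp (I * ((t * Real.log (t / (Real.exp 1 * (2 * π * μ * ν * h / k)))) : ℝ) : ℂ))
        else 0) := by
  -- the three factors
  have hΘ : thetaMainPhase t ^ 2 = cexp (I * ((t * Real.log (t / (2 * π)) - t - π / 4 : ℝ) : ℂ)) := by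
    rw [sq, thetaMainPhase_mul_self]
  have hS := mainSum_natFloor_eq_sum_ite ht.le hX
  have hA := normSq_mollPoly_eq a N t
  -- the square of the activated sum
  have hS2 : (mainSum ⌊Real.sqrt (t / (2 * π))⌋₊ t) ^ 2 =
      ∑ μ ∈ Finset.Icc 1 X, ∑ ν ∈ Finset.Icc 1 X,
        (if 2 * π * (μ : ℝ) ^ 2 ≤ t ∧ 2 * π * (ν : ℝ) ^ 2 ≤ t then
          ((((μ : ℝ) ^ (-(1 / 2 : ℝ)) : ℝ) : ℂ) * cexp (-(I * t * Real.log μ))) *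
            ((((ν : ℝ) ^ (-(1 / 2 : ℝ)) : ℝ) : ℂ) * cexp (-(I * t * Real.log ν))) else 0) := by
    rw [hS, sq, Finset.sum_mul_sum]
    refine Finset.sum_congr rfl fun μ _ => Finset.sum_congr rfl fun ν _ => ?_
    exact ite_zero_mul_ite_zero _ _ _ _
  rw [hΘ, hS2, hA, Finset.mul_sum]
  refine Finset.sum_congr rfl fun h hh => ?_
  rw [Finset.mul_sum]
  refine Finset.sum_congr rfl fun k hk => ?_
  rw [Finset.mul_sum, Finset.sum_mul]
  refine Finset.sum_congr rfl fun μ hμ => ?_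
  rw [Finset.mul_sum, Finset.sum_mul]
  refine Finset.sum_congr rfl fun ν hν => ?_
  have hh0 : 0 < h := (Finset.mem_Icc.1 hh).1
  have hk0 : 0 < k := (Finset.mem_Icc.1 hk).1
  have hμ0 : 0 < μ := (Finset.mem_Icc.1 hμ).1
  have hν0 : 0 < ν := (Finset.mem_Icc.1 hν).1
  split_ifs with hact
  · have hph := lemma922_phase_eq ht hμ0 hν0 hh0 hk0
    rw [rpow_neg_half_mul_cast μ ν]
    calc cexp (I * ((t * Real.log (t / (2 * π)) - t - π / 4 : ℝ) : ℂ)) *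
          ((((μ : ℝ) ^ (-(1 / 2 : ℝ)) : ℝ) : ℂ) * cexp (-(I * t * Real.log μ)) *
            ((((ν : ℝ) ^ (-(1 / 2 : ℝ)) : ℝ) : ℂ) * cexp (-(I * t * Real.log ν)))) *
          (a h * conj (a k) * ((((h : ℝ) * k) ^ (-(1 / 2 : ℝ)) : ℝ) : ℂ) *
            cexp (I * t * ((Real.log k - Real.log h : ℝ) : ℂ)))
        = a h * conj (a k) * ((((h : ℝ) * k) ^ (-(1 / 2 : ℝ)) : ℝ) : ℂ) *
          ((((μ : ℝ) ^ (-(1 / 2 : ℝ)) : ℝ) : ℂ) * (((ν : ℝ) ^ (-(1 / 2 : ℝ)) : ℝ) : ℂ)) *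
          (cexp (I * ((t * Real.log (t / (2 * π)) - t - π / 4 : ℝ) : ℂ))
            * (cexp (-(I * t * Real.log μ)) * cexp (-(I * t * Real.log ν)))
            * cexp (I * t * ((Real.log k - Real.log h : ℝ) : ℂ))) := by ring
      _ = _ := by rw [hph]
  · rw [mul_zero, zero_mul]

/-! ### Integrability of the two structured pieces -/

/-- Finite sums of interval-integrable functions, pointwise form. [folklore] -/
theorem intervalIntegrable_finset_sum_apply {ι : Type*} {s : Finset ι} {f : ι → ℝ → ℂ} {T T' : ℝ}
    (h : ∀ i ∈ s, IntervalIntegrable (f i) volume T T') :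
    IntervalIntegrable (fun t => ∑ i ∈ s, f i t) volume T T' := by
  have := IntervalIntegrable.sum s h
  refine this.congr_ae (Filter.Eventually.of_forall fun t => ?_)
  simp [Finset.sum_apply]

/-- One term of the quadruple sum is interval integrable on `[T, T']`, `0 < T ≤ T'`. [folklore] -/
theorem intervalIntegrable_crossTerm_summand {T T' : ℝ} (hT : 0 < T) (hTT' : T ≤ T') (C : ℂ) (c : ℝ)
    (θ₁ θ₂ : ℝ) :
    IntervalIntegrable (fun t : ℝ => if θ₁ ≤ t ∧ θ₂ ≤ t then
      C * cexp (I * ((t * Real.log (t / (Real.exp 1 * c))) : ℝ) : ℂ) else 0) volume T T' := by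
  have hfun : (fun t : ℝ => if θ₁ ≤ t ∧ θ₂ ≤ t then
      C * cexp (I * ((t * Real.log (t / (Real.exp 1 * c))) : ℝ) : ℂ) else 0) =
      fun t : ℝ => if max θ₁ θ₂ ≤ t then
        C * cexp (I * ((t * Real.log (t / (Real.exp 1 * c))) : ℝ) : ℂ) else 0 := by
    funext t; simp only [max_le_iff]
  rw [hfun]
  refine DirichletMVT.intervalIntegrable_ite_le hTT' ?_
  exact continuousOn_const.mul ((continuousOn_logPhase_exp c).mono fun t ht => hT.trans_le ht.1)

/-- **The cross-term integrand `Θ²S_t²|A|²` is interval integrable on `[T, T']`** (`0 < T ≤ T'`).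
[folklore] -/
theorem intervalIntegrable_crossIntegrand (a : ℕ → ℂ) (N : ℕ) {T T' : ℝ} (hT : 0 < T) (hTT' : T ≤ T') :
    IntervalIntegrable (fun t : ℝ => thetaMainPhase t ^ 2 * (mainSum ⌊Real.sqrt (t / (2 * π))⌋₊ t) ^ 2 *
      (((‖mollPoly a N t‖ ^ 2 : ℝ)) : ℂ)) volume T T' := by
  set X : ℕ := ⌊Real.sqrt (T' / (2 * π))⌋₊ with hXdef
  -- replace the integrand by the quadruple sum on `[T, T']`
  have heq : EqOn (fun t : ℝ => thetaMainPhase t ^ 2 * (mainSum ⌊Real.sqrt (t / (2 * π))⌋₊ t) ^ 2 *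
      (((‖mollPoly a N t‖ ^ 2 : ℝ)) : ℂ))
      (fun t : ℝ => ∑ h ∈ Finset.Icc 1 N, ∑ k ∈ Finset.Icc 1 N, ∑ μ ∈ Finset.Icc 1 X, ∑ ν ∈ Finset.Icc 1 X,
        (if 2 * π * (μ : ℝ) ^ 2 ≤ t ∧ 2 * π * (ν : ℝ) ^ 2 ≤ t then
          a h * conj (a k) * ((((h : ℝ) * k) ^ (-(1 / 2 : ℝ)) : ℝ) : ℂ) *
            ((((μ : ℝ) * ν) ^ (-(1 / 2 : ℝ)) : ℝ) : ℂ) *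
            (cexp (-(I * (π / 4 : ℝ))) *
              cexp (I * ((t * Real.log (t / (Real.exp 1 * (2 * π * μ * ν * h / k)))) : ℝ) : ℂ))
        else 0)) (uIcc T T') := by
    intro t ht
    rw [uIcc_of_le hTT'] at ht
    exact crossIntegrand_eq a N (hT.trans_le ht.1) ((natFloor_sqrt_mono ht.2).trans le_rfl)
  refine (intervalIntegrable_congr (heq.mono uIoc_subset_uIcc)).2 ?_
  refine intervalIntegrable_finset_sum_apply fun h _ => intervalIntegrable_finset_sum_apply fun k _ =>
    intervalIntegrable_finset_sum_apply fun μ _ => intervalIntegrable_finset_sum_apply fun ν _ => ?_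
  have := intervalIntegrable_crossTerm_summand hT hTT'
    (a h * conj (a k) * ((((h : ℝ) * k) ^ (-(1 / 2 : ℝ)) : ℝ) : ℂ) *
      ((((μ : ℝ) * ν) ^ (-(1 / 2 : ℝ)) : ℝ) : ℂ) * cexp (-(I * (π / 4 : ℝ))))
    (2 * π * μ * ν * h / k) (2 * π * (μ : ℝ) ^ 2) (2 * π * (ν : ℝ) ^ 2)
  refine this.congr_ae (Filter.Eventually.of_forall fun t => ?_)
  dsimp only
  split_ifs <;> ring

/-- **`|S_t A(½+it)|²` is interval integrable on `[T, T']`** (`0 < T ≤ T'`): the activated product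
expands into activated terms `[2πμ² ≤ t][2πν² ≤ t] · (const) · e^{it(…)}`. [folklore] -/
theorem intervalIntegrable_normSq_actProd (a : ℕ → ℂ) (N : ℕ) {T T' : ℝ} (hT : 0 < T) (hTT' : T ≤ T') :
    IntervalIntegrable (fun t : ℝ =>
      (((‖mainSum ⌊Real.sqrt (t / (2 * π))⌋₊ t * mollPoly a N t‖ ^ 2 : ℝ)) : ℂ)) volume T T' := by
  set X : ℕ := ⌊Real.sqrt (T' / (2 * π))⌋₊ with hXdef
  -- the terms
  set term : ℕ → ℝ → ℂ := fun μ t =>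
    (((μ : ℝ) ^ (-(1 / 2 : ℝ)) : ℝ) : ℂ) * cexp (-(I * t * Real.log μ)) with hterm
  set E : ℕ → ℕ → ℝ → ℂ := fun μ ν t =>
    cexp (((t * (Real.log ν - Real.log μ)) : ℝ) * I) with hE
  have hEcont : ∀ μ ν, Continuous (E μ ν) := by intro μ ν; simp only [hE]; fun_prop
  -- `|S_t|²` as an activated double sum
  have hSS : ∀ t : ℝ, 0 ≤ t → ⌊Real.sqrt (t / (2 * π))⌋₊ ≤ X →
      (((‖mainSum ⌊Real.sqrt (t / (2 * π))⌋₊ t‖ ^ 2 : ℝ)) : ℂ) =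
        ∑ μ ∈ Finset.Icc 1 X, ∑ ν ∈ Finset.Icc 1 X,
          (if 2 * π * (μ : ℝ) ^ 2 ≤ t ∧ 2 * π * (ν : ℝ) ^ 2 ≤ t then
            ((((μ : ℝ) * ν) ^ (-(1 / 2 : ℝ)) : ℝ) : ℂ) * E μ ν t else 0) := by
    intro t ht hX
    have e : (((‖mainSum ⌊Real.sqrt (t / (2 * π))⌋₊ t‖ ^ 2 : ℝ)) : ℂ) =
        mainSum ⌊Real.sqrt (t / (2 * π))⌋₊ t * conj (mainSum ⌊Real.sqrt (t / (2 * π))⌋₊ t) := by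
      rw [Complex.mul_conj, Complex.normSq_eq_norm_sq, Complex.ofReal_pow]
    rw [e, mainSum_natFloor_eq_sum_ite ht hX, map_sum, Finset.sum_mul_sum]
    refine Finset.sum_congr rfl fun μ hμ => Finset.sum_congr rfl fun ν hν => ?_
    rw [show conj (if 2 * π * (ν : ℝ) ^ 2 ≤ t then
        (((ν : ℝ) ^ (-(1 / 2 : ℝ)) : ℝ) : ℂ) * cexp (-(I * t * Real.log ν)) else 0) =
        if 2 * π * (ν : ℝ) ^ 2 ≤ t then conj ((((ν : ℝ) ^ (-(1 / 2 : ℝ)) : ℝ) : ℂ) *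
          cexp (-(I * t * Real.log ν))) else 0 by split_ifs <;> simp, ite_zero_mul_ite_zero]
    split_ifs with hact
    · rw [conj_term, rpow_neg_half_mul_cast]
      have hexp : cexp (-(I * t * Real.log μ)) * cexp (I * t * Real.log ν) = E μ ν t := by
        simp only [hE]
        rw [← Complex.exp_add]
        congr 1
        push_cast
        ring
      calc (((μ : ℝ) ^ (-(1 / 2 : ℝ)) : ℝ) : ℂ) * cexp (-(I * t * Real.log μ)) *
            ((((ν : ℝ) ^ (-(1 / 2 : ℝ)) : ℝ) : ℂ) * cexp (I * t * Real.log ν))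
          = (((μ : ℝ) ^ (-(1 / 2 : ℝ)) : ℝ) : ℂ) * (((ν : ℝ) ^ (-(1 / 2 : ℝ)) : ℝ) : ℂ) *
            (cexp (-(I * t * Real.log μ)) * cexp (I * t * Real.log ν)) := by ring
        _ = _ := by rw [hexp]
    · rfl
  -- `|S_t A|² = |S_t|² |A|²`, both expanded
  have heq : EqOn (fun t : ℝ => (((‖mainSum ⌊Real.sqrt (t / (2 * π))⌋₊ t * mollPoly a N t‖ ^ 2 : ℝ)) : ℂ))
      (fun t : ℝ => ∑ μ ∈ Finset.Icc 1 X, ∑ ν ∈ Finset.Icc 1 X,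
        ∑ h ∈ Finset.Icc 1 N, ∑ k ∈ Finset.Icc 1 N,
          (if 2 * π * (μ : ℝ) ^ 2 ≤ t ∧ 2 * π * (ν : ℝ) ^ 2 ≤ t then
            (((((μ : ℝ) * ν) ^ (-(1 / 2 : ℝ)) : ℝ) : ℂ) *
              (a h * conj (a k) * ((((h : ℝ) * k) ^ (-(1 / 2 : ℝ)) : ℝ) : ℂ))) *
              (E μ ν t * cexp (I * t * ((Real.log k - Real.log h : ℝ) : ℂ))) else 0)) (uIcc T T') := by
    intro t ht
    rw [uIcc_of_le hTT'] at ht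
    have ht0 : 0 < t := hT.trans_le ht.1
    show (((‖mainSum ⌊Real.sqrt (t / (2 * π))⌋₊ t * mollPoly a N t‖ ^ 2 : ℝ)) : ℂ) = _
    rw [norm_mul, mul_pow, Complex.ofReal_mul, hSS t ht0.le (natFloor_sqrt_mono ht.2),
      normSq_mollPoly_eq, Finset.sum_mul]
    refine Finset.sum_congr rfl fun μ _ => ?_
    rw [Finset.sum_mul]
    refine Finset.sum_congr rfl fun ν _ => ?_
    rw [Finset.mul_sum]
    refine Finset.sum_congr rfl fun h _ => ?_
    rw [Finset.mul_sum]
    refine Finset.sum_congr rfl fun k _ => ?_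
    split_ifs
    · ring
    · rw [zero_mul]
  refine (intervalIntegrable_congr (heq.mono uIoc_subset_uIcc)).2 ?_
  refine intervalIntegrable_finset_sum_apply fun μ _ => intervalIntegrable_finset_sum_apply fun ν _ =>
    intervalIntegrable_finset_sum_apply fun h _ => intervalIntegrable_finset_sum_apply fun k _ => ?_
  have hfun : (fun t : ℝ => if 2 * π * (μ : ℝ) ^ 2 ≤ t ∧ 2 * π * (ν : ℝ) ^ 2 ≤ t then
      (((((μ : ℝ) * ν) ^ (-(1 / 2 : ℝ)) : ℝ) : ℂ) *
        (a h * conj (a k) * ((((h : ℝ) * k) ^ (-(1 / 2 : ℝ)) : ℝ) : ℂ))) *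
        (E μ ν t * cexp (I * t * ((Real.log k - Real.log h : ℝ) : ℂ))) else 0) =
      fun t : ℝ => if max (2 * π * (μ : ℝ) ^ 2) (2 * π * (ν : ℝ) ^ 2) ≤ t then
        (((((μ : ℝ) * ν) ^ (-(1 / 2 : ℝ)) : ℝ) : ℂ) *
          (a h * conj (a k) * ((((h : ℝ) * k) ^ (-(1 / 2 : ℝ)) : ℝ) : ℂ))) *
          (E μ ν t * cexp (I * t * ((Real.log k - Real.log h : ℝ) : ℂ))) else 0 := by
    funext t; simp only [max_le_iff]
  rw [hfun]
  refine DirichletMVT.intervalIntegrable_ite_le hTT' (continuousOn_const.mul ?_)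
  refine ((hEcont μ ν).mul ?_).continuousOn
  fun_prop

/-! ### The cross term as a quadruple sum of activated log-phase integrals -/

/-- **The cross term as a quadruple sum.** For `0 < T ≤ T'` and `⌊√(T'/2π)⌋ ≤ X`:
`∫_T^{T'} Θ²S_t²|A(½+it)|² dt = e^{-iπ/4} Σ_{h,k ≤ N} a_h ā_k (hk)^{-1/2} Σ_{μ,ν ≤ X} (μν)^{-1/2}`
`   · ∫_T^{T'} [2πμ² ≤ t ∧ 2πν² ≤ t] e^{it log(t/(e · 2πμνh/k))} dt`. [cite: Titchmarsh1986, §9.22] -/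
theorem crossTerm_eq (a : ℕ → ℂ) (N : ℕ) {T T' : ℝ} (hT : 0 < T) (hTT' : T ≤ T') {X : ℕ}
    (hX : ⌊Real.sqrt (T' / (2 * π))⌋₊ ≤ X) :
    (∫ t in T..T', thetaMainPhase t ^ 2 * (mainSum ⌊Real.sqrt (t / (2 * π))⌋₊ t) ^ 2 *
        (((‖mollPoly a N t‖ ^ 2 : ℝ)) : ℂ)) =
      cexp (-(I * (π / 4 : ℝ))) * ∑ h ∈ Finset.Icc 1 N, ∑ k ∈ Finset.Icc 1 N,
        a h * conj (a k) * ((((h : ℝ) * k) ^ (-(1 / 2 : ℝ)) : ℝ) : ℂ) *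
          ∑ μ ∈ Finset.Icc 1 X, ∑ ν ∈ Finset.Icc 1 X, ((((μ : ℝ) * ν) ^ (-(1 / 2 : ℝ)) : ℝ) : ℂ) *
            ∫ t in T..T', (if 2 * π * (μ : ℝ) ^ 2 ≤ t ∧ 2 * π * (ν : ℝ) ^ 2 ≤ t then
              cexp (I * ((t * Real.log (t / (Real.exp 1 * (2 * π * μ * ν * h / k)))) : ℝ) : ℂ)
              else 0) := by
  -- the summands, with the constants inside
  set G : ℕ → ℕ → ℕ → ℕ → ℝ → ℂ := fun h k μ ν t =>
    if 2 * π * (μ : ℝ) ^ 2 ≤ t ∧ 2 * π * (ν : ℝ) ^ 2 ≤ t then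
      a h * conj (a k) * ((((h : ℝ) * k) ^ (-(1 / 2 : ℝ)) : ℝ) : ℂ) *
        ((((μ : ℝ) * ν) ^ (-(1 / 2 : ℝ)) : ℝ) : ℂ) *
        (cexp (-(I * (π / 4 : ℝ))) *
          cexp (I * ((t * Real.log (t / (Real.exp 1 * (2 * π * μ * ν * h / k)))) : ℝ) : ℂ))
    else 0 with hG
  have hGint : ∀ h k μ ν, IntervalIntegrable (G h k μ ν) volume T T' := by
    intro h k μ ν
    have := intervalIntegrable_crossTerm_summand hT hTT'
      (a h * conj (a k) * ((((h : ℝ) * k) ^ (-(1 / 2 : ℝ)) : ℝ) : ℂ) *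
        ((((μ : ℝ) * ν) ^ (-(1 / 2 : ℝ)) : ℝ) : ℂ) * cexp (-(I * (π / 4 : ℝ))))
      (2 * π * μ * ν * h / k) (2 * π * (μ : ℝ) ^ 2) (2 * π * (ν : ℝ) ^ 2)
    refine this.congr_ae (Filter.Eventually.of_forall fun t => ?_)
    simp only [hG]
    split_ifs <;> ring
  -- Step 1: the integrand equals the quadruple sum on `[T, T']`
  have h1 : (∫ t in T..T', thetaMainPhase t ^ 2 * (mainSum ⌊Real.sqrt (t / (2 * π))⌋₊ t) ^ 2 *
        (((‖mollPoly a N t‖ ^ 2 : ℝ)) : ℂ)) =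
      ∫ t in T..T', ∑ h ∈ Finset.Icc 1 N, ∑ k ∈ Finset.Icc 1 N, ∑ μ ∈ Finset.Icc 1 X,
        ∑ ν ∈ Finset.Icc 1 X, G h k μ ν t := by
    refine intervalIntegral.integral_congr fun t ht => ?_
    rw [uIcc_of_le hTT'] at ht
    exact crossIntegrand_eq a N (hT.trans_le ht.1) ((natFloor_sqrt_mono ht.2).trans hX)
  -- Step 2: interchange
  have h2 : (∫ t in T..T', ∑ h ∈ Finset.Icc 1 N, ∑ k ∈ Finset.Icc 1 N, ∑ μ ∈ Finset.Icc 1 X,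
        ∑ ν ∈ Finset.Icc 1 X, G h k μ ν t) =
      ∑ h ∈ Finset.Icc 1 N, ∑ k ∈ Finset.Icc 1 N, ∑ μ ∈ Finset.Icc 1 X, ∑ ν ∈ Finset.Icc 1 X,
        ∫ t in T..T', G h k μ ν t := by
    rw [intervalIntegral.integral_finsetSum fun h _ => intervalIntegrable_finset_sum_apply fun k _ =>
      intervalIntegrable_finset_sum_apply fun μ _ => intervalIntegrable_finset_sum_apply fun ν _ =>
        hGint h k μ ν]
    refine Finset.sum_congr rfl fun h _ => ?_
    rw [intervalIntegral.integral_finsetSum fun k _ =>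
      intervalIntegrable_finset_sum_apply fun μ _ => intervalIntegrable_finset_sum_apply fun ν _ =>
        hGint h k μ ν]
    refine Finset.sum_congr rfl fun k _ => ?_
    rw [intervalIntegral.integral_finsetSum fun μ _ => intervalIntegrable_finset_sum_apply fun ν _ =>
      hGint h k μ ν]
    refine Finset.sum_congr rfl fun μ _ => ?_
    rw [intervalIntegral.integral_finsetSum fun ν _ => hGint h k μ ν]
  -- Step 3: pull out the constants
  have h3 : ∀ h k μ ν, (∫ t in T..T', G h k μ ν t) =
      a h * conj (a k) * ((((h : ℝ) * k) ^ (-(1 / 2 : ℝ)) : ℝ) : ℂ) *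
        ((((μ : ℝ) * ν) ^ (-(1 / 2 : ℝ)) : ℝ) : ℂ) * cexp (-(I * (π / 4 : ℝ))) *
        ∫ t in T..T', (if 2 * π * (μ : ℝ) ^ 2 ≤ t ∧ 2 * π * (ν : ℝ) ^ 2 ≤ t then
          cexp (I * ((t * Real.log (t / (Real.exp 1 * (2 * π * μ * ν * h / k)))) : ℝ) : ℂ)
          else 0) := by
    intro h k μ ν
    rw [← intervalIntegral.integral_const_mul]
    refine intervalIntegral.integral_congr fun t _ => ?_
    simp only [hG]
    split_ifs
    · ring
    · rw [mul_zero]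
  rw [h1, h2, Finset.mul_sum]
  refine Finset.sum_congr rfl fun h _ => ?_
  rw [Finset.mul_sum]
  refine Finset.sum_congr rfl fun k _ => ?_
  rw [Finset.mul_sum, Finset.mul_sum]
  refine Finset.sum_congr rfl fun μ _ => ?_
  rw [Finset.mul_sum, Finset.mul_sum]
  refine Finset.sum_congr rfl fun ν _ => ?_
  rw [h3]
  ring

/-- The activated inner integrals are ordinary log-phase integrals from `max(T, 2π max(μ,ν)²)`:
`∫_T^{T'} [2πμ² ≤ t ∧ 2πν² ≤ t] f = [2π max² ≤ T'] ∫_{max(T, max(2πμ², 2πν²))}^{T'} f`. [folklore] -/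
theorem integral_ite_and_le_eq (f : ℝ → ℂ) {T T' : ℝ} (hTT' : T ≤ T') (θ₁ θ₂ : ℝ) :
    (∫ t in T..T', (if θ₁ ≤ t ∧ θ₂ ≤ t then f t else 0)) =
      if max θ₁ θ₂ ≤ T' then ∫ t in max T (max θ₁ θ₂)..T', f t else 0 := by
  have hfun : (fun t : ℝ => if θ₁ ≤ t ∧ θ₂ ≤ t then f t else 0) =
      fun t : ℝ => if max θ₁ θ₂ ≤ t then f t else 0 := by
    funext t; simp only [max_le_iff]
  rw [hfun]
  exact DirichletMVT.integral_ite_le_eq f _ hTT'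

end Literature.NumberTheory.LFunctions.BCH
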